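import Summits.CriticalPhenomena.PercolationContinuityZ3.Theorems.PercShatteringRaceNearLinearTwoClusterDecayOfSparseShellNonCertainty
import Summits.CriticalPhenomena.PercolationContinuityZ3.Theorems.PercShatteringRaceNearLinearTwoClusterDecayShellRestriction
import Summits.CriticalPhenomena.PercolationContinuityZ3.Theorems.PercShatteringRaceNearLinearTwoClusterDecayStubShellIndependence
import Literature.Probability.Percolation.CriticalContinuityProofs
import Literature.Probability.Percolation.SharpnessDCTProofs

/-!
# Line `shell-product-kiss-positivity` — lead skeleton rev L1-c1 for the crux
# `PercShatteringRace.NearLinearTwoClusterDecay` (stmt-CriticalPhenomena-5785, route `PercShatteringRace`, rank 2)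

Lead prover-line-stmt-CriticalPhenomena-5785-c1-0 (seat c1), 2026-08-16.  Planner skeleton:
`Cruxes/NearLinearTwoClusterDecay/Lines/shell_product_kiss_positivity.lean` (5 stubs); idea cards
`shell-product-kiss-positivity` (ideator 3) and `single-edge-doors-flux-balance` (ideator 3 g2, merged here).

Crux (fixed, concluded BY NAME below): `U(1/6)` — at `p_c(ℤ³)` (bond), the probability that the
configuration restricted to `Λ(m)`, `m = ⌈n^{7/6}⌉`, contains two in-box-distinct open clusters each meeting
`Λ(n)` and `∂ⁱⁿΛ(m)` tends to `0`.

## What the lead changed (rev L1-c1) and why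

* The SHELL PRODUCT + TRANSFER is no longer a pair of stubs: the peel inequality, disjoint-shell independence,
  the geometric chain and the transfer at every aspect exponent are LANDED theorems of the tree
  (`Theorems/PercShatteringRaceNearLinearTwoClusterDecayOf[Sparse]ShellNonCertainty.lean`,
  `…ShellRestriction.lean`: p85433, p85476, p87166, p89409, p89737, p90414).  The only new ingredient is the
  ENCODING of the landed open-shell event `Sh(N, R)` into this line's closed-shell counting vocabulary
  (`stub_shellEncoding`, provable now, size S–M); `crux_of_goodTwo` is now fifteen lines on top of
  `real_shellTwoCluster_antitone` and `nearLinearTwoClusterDecay_of_fixedAspectShellNonCertainty`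
  (the aspect doubles: `NP` at closed-shell aspect `M` gives the clean open-shell `NP_{2M}`).
* The SURGERY stub (`stub_kissSurgery`, "bounded multiplicity", no known mechanism as filed) is RESHAPED along
  the companion card `single-edge-doors-flux-balance`: at fixed `p` the single-edge flip `(ω, e) ↦ (ω ∪ e, e)`
  carries `{N = k, e a kiss edge}` into `{N = k-1, e a splitting bridge}` at cost `p` (insertion tolerance,
  tree `AKN.mul_real_preimage_insert_le`), whence
  `p · P(N = k, Kiss) ≤ E[F_k ; N = k-1]` for the FIBRE WEIGHT `F_k(ω') = Σ_{bridges b} 1/K_k(ω' ∖ b)`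
  (`stub_doorTransfer`, provable now), and Cauchy–Schwarz `E[F]² ≤ P(F ≠ 0) E[F²]` (`stub_doorCauchySchwarz`,
  provable now) leaves ONE open shape input, `stub_boundedFibre`: `E[F_k² ; N = k-1] ≤ C · E[F_k ; N = k-1]`
  (numerically the card's flat `Φ = 1.5–2.3`, `M = 8`, `r = 4…16`, kit j012975/j012976).  The combinatorial
  heart "opening a kiss edge lowers `N` by exactly one" is `stub_kissMerge` (provable now).  Stubs 4–6 are
  stated GENERICALLY (any finite pair set `E`, any family of levels `L`, any door selection `D`), so that they
  land as reusable Literature-grade lemmas over tree vocabulary only.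
* Registered stubs (7 = stubs_max): `stub_shellEncoding` (S–M, provable) · `stub_tightAtSomeAspect`
  (OPEN, THE BET, the lead's) · `stub_kissPositivity` (OPEN) · `stub_kissMerge` (M, provable) ·
  `stub_doorTransfer` (M–L, provable) · `stub_doorCauchySchwarz` (M, provable) · `stub_boundedFibre` (OPEN,
  shape).  Everything else is proved in this file: the instantiation glue (determinedness of the counting
  events, kiss edges are closed lattice pairs of the shell, `Kiss ⇒` a kiss edge), `kissSurgery` (from stubs
  4–7), the descent (`descent_step`, `good_two_of_tight`, planner's arithmetic verbatim), the transfer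
  (`crux_of_goodTwo`) and the composition `NearLinearTwoClusterDecay_of` (+ `critBoxTwoArmsDecay_of`,
  stmt-0859, for free).

## Disproof.lean (cdisprove v6, RESISTS; read 2026-08-16T10:30Z) honoured
`nearLinearTwoClusterDecay_false_without_arms`: every counted cluster meets BOTH spheres (`crossPts`,
`crossBody`); `not_atExponent_of_le_one` / `not_tendsto_additive_aspect` / near-miss (e): every per-shell stub
is `≤ 1 - c` at ONE bounded multiplicative aspect, decay comes only from the landed chain's `≍ log n` skins;
`real_twoClusterEvt_le_sq` / `percolationContinuityZ3_of_crossingDecay`: no stub bounds a crossing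
probability (jump-compatible line).  `-- Targets`: none for this line yet.  No stub is an instance of a refuted
strengthening (eventually-null, exponent `≤ 1`, additive aspect).
-/

noncomputable section

namespace Summit.CriticalPhenomena.PercolationContinuityZ3.Cruxes.NearLinearTwoClusterDecay.ShellProductKissPositivity

open MeasureTheory Filter Topology
open Literature.Probability.LatticeModels Literature.Probability.Percolation
open Summit.CriticalPhenomena.PercolationContinuityZ3.Theses.PercShatteringRace

/-! ### Vocabulary of the line (transparent packaging over existing declarations) -/

/-- Critical bond percolation `P_{p_c}` on `ℤ³`. -/
abbrev Pc : Measure (BondConfig (Site 3)) := bondPercolation (zdGraph 3) (criticalProbI 3)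

/-- The sphere `{‖v‖∞ = r}` = inner vertex boundary of `Λ(r) = box 3 r`. -/
abbrev sphere (r : ℕ) : Finset (Site 3) := innerBoundary (zdGraph 3) (box 3 r)

/-- The CLOSED shell `S(r,R) = {r ≤ ‖v‖∞ ≤ R}` = `Λ(R)` minus the interior of `Λ(r)`. -/
def shell (r R : ℕ) : Set (Site 3) :=
  (↑(box 3 R) : Set (Site 3)) \ ((↑(box 3 r) : Set (Site 3)) \ ↑(sphere r))

/-- The closed shell as a `Finset` of sites. -/
def shellF (r R : ℕ) : Finset (Site 3) := box 3 R \ (box 3 r \ sphere r)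

/-- All unordered PAIRS of shell sites (a finite set containing every lattice edge of the shell; the
counting events below are determined by the states of these pairs). -/
def shellPairs (r R : ℕ) : Finset (Sym2 (Site 3)) := (shellF r R).sym2

/-- The CROSSING POINTS of the shell `S(r,R)` in `ω`: the `x ∈ sphere r` joined INSIDE the shell (free shell
configuration) to a vertex of `sphere R`. -/
def crossPts (r R : ℕ) (ω : BondConfig (Site 3)) : Set (Site 3) :=
  {x | x ∈ sphere r ∧ ∃ y ∈ sphere R, ω ∈ openConnIn (shell r R) x y}

/-- `{N(r,R) ≥ k}`: there are `k` pairwise shell-disconnected crossing points, i.e. at least `k` distinct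
shell-crossing clusters. -/
def AtLeast (r R k : ℕ) : Set (BondConfig (Site 3)) :=
  {ω | ∃ x : Fin k → Site 3, (∀ i, x i ∈ crossPts r R ω) ∧
      ∀ i j, i ≠ j → ω ∉ openConnIn (shell r R) (x i) (x j)}

/-- `{N(r,R) = k}`: at least `k` but not `k + 1` distinct shell-crossing clusters. -/
def Level (r R k : ℕ) : Set (BondConfig (Site 3)) := AtLeast r R k \ AtLeast r R (k + 1)

/-- The BODY of the crossing clusters of the shell: the vertices `u` joined inside the shell to both spheres. -/
def crossBody (r R : ℕ) (ω : BondConfig (Site 3)) : Set (Site 3) :=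
  {u | ∃ x ∈ sphere r, ∃ y ∈ sphere R, ω ∈ openConnIn (shell r R) x u ∧ ω ∈ openConnIn (shell r R) u y}

/-- A KISS: two lattice-ADJACENT vertices `u ~ v` lying on two DISTINCT crossing clusters of the shell. -/
def Kiss (r R : ℕ) : Set (BondConfig (Site 3)) :=
  {ω | ∃ u v : Site 3, (zdGraph 3).Adj u v ∧ u ∈ crossBody r R ω ∧ v ∈ crossBody r R ω ∧
      ω ∉ openConnIn (shell r R) u v}

open Classical in
/-- The KISS EDGES (= the "doors" of the companion card) of `ω`: lattice edges `uv` of the shell whose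
endpoints lie on two distinct crossing clusters (`K(ω)` = their number). -/
def kissEdges (r R : ℕ) (ω : BondConfig (Site 3)) : Finset (Sym2 (Site 3)) :=
  (shellPairs r R).filter fun e => e ∈ (zdGraph 3).edgeSet ∧
    ∃ u v : Site 3, e = s(u, v) ∧ u ∈ crossBody r R ω ∧ v ∈ crossBody r R ω ∧
      ω ∉ openConnIn (shell r R) u v

/-- The FIBRE WEIGHT at level `k` of a configuration `ω'` (meant on `{N = k-1}`):
`F_k(ω') = Σ_b 1{b open, ω' ∖ b ∈ {N = k}, b a kiss edge of ω' ∖ b} / K(ω' ∖ b)` — each splitting bridge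
weighted by the reciprocal of the number of kiss edges of the level-`k` configuration it came from. -/
def fibre (r R k : ℕ) (ω : BondConfig (Site 3)) : ℝ :=
  ∑ b ∈ shellPairs r R,
    Set.indicator {ω' : BondConfig (Site 3) | b ∈ ω' ∧ ω' \ {b} ∈ Level r R k ∧ b ∈ kissEdges r R (ω' \ {b})}
      (fun ω' => (1 : ℝ) / ((kissEdges r R (ω' \ {b})).card : ℝ)) ω

/-- The route's two-cluster event with a general outer radius `m`. -/
def TwoBoxClusters (n m : ℕ) : Set (BondConfig (Site 3)) :=
  {ω | ∃ x ∈ box 3 n, ∃ x' ∈ box 3 n, ∃ y ∈ innerBoundary (zdGraph 3) (box 3 m),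
      ∃ y' ∈ innerBoundary (zdGraph 3) (box 3 m),
        ω ∈ openConnIn ↑(box 3 m) x y ∧ ω ∈ openConnIn ↑(box 3 m) x' y' ∧
          ω ∉ openConnIn ↑(box 3 m) x x'}

/-- Read-back: the crux is literally `P(A₂(n, ⌈n^{7/6}⌉)) → 0` in this vocabulary. -/
theorem crux_iff :
    NearLinearTwoClusterDecay ↔
      Tendsto (fun n : ℕ => Pc.real (TwoBoxClusters n ⌈(n : ℝ) ^ ((7 : ℝ) / 6)⌉₊)) atTop (𝓝 0) :=
  Iff.rfl

/-! ### Registered stubs (7) -/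

/-- **stub_shellEncoding** (size S–M, provable now; deterministic).  The landed OPEN-SHELL two-cluster event
`Sh(N, R)` ("the configuration restricted to `Λ(R) ∖ Λ(N)` has two shell-distinct open clusters from the layer
`Λ(N+1) ∖ Λ(N)` to `∂ⁱⁿΛ(R)`", verbatim the hypothesis event of
`Theorems.nearLinearTwoClusterDecay_of_fixedAspectShellNonCertainty`) is contained in this line's
`{N(N+1, R) ≥ 2} = AtLeast (N+1) R 2` (spelled out).  Why true: the two vertex sets coincide,
`Λ(R) ∖ Λ(N) = Λ(R) ∖ (Λ(N+1) ∖ ∂ⁱⁿΛ(N+1)) = {N+1 ≤ ‖v‖∞ ≤ R}` (`mem_box`, `mem_innerBoundary_iff`: a site of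
sup-norm `N+1` has the neighbour `v + sign(v_i) e_i` outside `Λ(N+1)`), and a layer point `u ∈ Λ(N+1) ∖ Λ(N)`
lies on `∂ⁱⁿΛ(N+1)`; so the two witnesses `u, u'` ARE two shell-disconnected crossing points
(`x = ![u, u']`, `openConnIn` in the same set; symmetry of `openConnIn` for the pair `(1,0)`). -/
theorem stub_shellEncoding :
    ∀ (N R : ℕ) (ω : BondConfig (Site 3)),
      (∃ u ∈ (↑(box 3 (N + 1)) : Set (Site 3)) \ ↑(box 3 N),
        ∃ u' ∈ (↑(box 3 (N + 1)) : Set (Site 3)) \ ↑(box 3 N),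
        ∃ v ∈ innerBoundary (zdGraph 3) (box 3 R), ∃ v' ∈ innerBoundary (zdGraph 3) (box 3 R),
          ω ∈ openConnIn ((↑(box 3 R) : Set (Site 3)) \ ↑(box 3 N)) u v ∧
          ω ∈ openConnIn ((↑(box 3 R) : Set (Site 3)) \ ↑(box 3 N)) u' v' ∧
          ω ∉ openConnIn ((↑(box 3 R) : Set (Site 3)) \ ↑(box 3 N)) u u') →
      ∃ x : Fin 2 → Site 3,
        (∀ i, x i ∈ innerBoundary (zdGraph 3) (box 3 (N + 1)) ∧
          ∃ y ∈ innerBoundary (zdGraph 3) (box 3 R),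
            ω ∈ openConnIn ((↑(box 3 R) : Set (Site 3)) \
              ((↑(box 3 (N + 1)) : Set (Site 3)) \ ↑(innerBoundary (zdGraph 3) (box 3 (N + 1))))) (x i) y) ∧
        ∀ i j, i ≠ j → ω ∉ openConnIn ((↑(box 3 R) : Set (Site 3)) \
          ((↑(box 3 (N + 1)) : Set (Site 3)) \ ↑(innerBoundary (zdGraph 3) (box 3 (N + 1))))) (x i) (x j) := by
  sorry

/-- **stub_tightAtSomeAspect** — THE BET, hardest stub, the lead's (size XL, open-problem grade; the `d < 6`
content of the whole line, false for `d ≥ 7` under `η = 0` where `N_L ≍ L^{d-6}`,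
`Literature.Barriers.CriticalPhenomena.SpanningClustersAboveSix`).  **Tightness of the shell-crossing number
at SOME bounded aspect, positive-probability form**: there are `M ≥ 2`, `k₀` and `c₀ > 0` with
`P(N(r, Mr) ≤ k₀) ≥ c₀` for all large `r`.  Jump-compatible, rate-free, single-scale.  Numerically immediate:
`N(r,Mr) ≤ 9 / 5 / 3` in every sample at `M = 4 / 8 / 16` (`r ≤ 16`), laws scale-invariant
(NumericsIdeator3.md; NumericsLeadShellNC.md: `P(N ≤ 1)` r-flat `≈ 0.78` at `M = 16`, `≈ 0.95` at `M = 32`). -/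
theorem stub_tightAtSomeAspect :
    ∃ M : ℕ, 2 ≤ M ∧ ∃ k₀ : ℕ, ∃ c₀ : ℝ, 0 < c₀ ∧ ∃ r₀ : ℕ, ∀ r : ℕ, r₀ ≤ r →
      Pc.real (AtLeast r (M * r) (k₀ + 1)) ≤ 1 - c₀ := by
  sorry

/-- **stub_kissPositivity** (OPEN, size L–XL; planner's registered signature verbatim).  **Kiss positivity in
the tight regime.**  If `TightAt(M, k₀)`, then for every level `2 ≤ k ≤ k₀` there is `c > 0` with
`c · P(N(r,Mr) = k) ≤ P(N(r,Mr) = k, Kiss)` for all large `r`.  Numerically saturated (`P(Kiss | N = 2)`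
= 0.87–0.92 flat in `r ≤ 16` at `M = 8`, 0.96–1.0 at `M = 16`). -/
theorem stub_kissPositivity :
    ∀ (M k₀ k : ℕ), 2 ≤ M →
      (∃ c₀ : ℝ, 0 < c₀ ∧ ∃ r₀ : ℕ, ∀ r : ℕ, r₀ ≤ r → Pc.real (AtLeast r (M * r) (k₀ + 1)) ≤ 1 - c₀) →
      2 ≤ k → k ≤ k₀ →
        ∃ c : ℝ, 0 < c ∧ ∃ r₁ : ℕ, ∀ r : ℕ, r₁ ≤ r →
          c * Pc.real (Level r (M * r) k) ≤ Pc.real (Level r (M * r) k ∩ Kiss r (M * r)) := by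
  sorry

/-- **stub_kissMerge** (size M, provable now; deterministic, GENERIC over the shell `S` and the two target sets
`A` (inner sphere) and `B` (outer sphere)).  **Opening a kiss edge lowers the crossing number by exactly one.**
If `u ~ v` are lattice neighbours, each joined inside `S` to `A` and to `B` (they lie on crossing clusters),
not joined to each other inside `S`, and `ω` has EXACTLY `k + 1` pairwise `S`-disconnected `A→B` crossing
points (`k+1` exist, `k+2` do not), then `insert s(u,v) ω` has exactly `k`.  Why true: (i) crossing points do
not change (a crossing of `ω ∪ e` through `e` reaches `u` or `v` in `ω`, which already cross); (ii) `≤ k`: among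
`k+1` pairwise `(ω∪e)`-disconnected crossing points two represent the classes of `u` and `v`, which `e` joins;
(iii) `≥ k`: drop the representative of `v`'s class from an `ω`-family of `k+1`; a new connection through `e`
would identify a survivor with `v`'s class (tree pattern `AKN.reachable_insert_or`, `PathIn.trans/symm`).
(Necessarily `k ≥ 1`; the statement is vacuous otherwise.) -/
theorem stub_kissMerge :
    ∀ (S A B : Set (Site 3)) (k : ℕ) (ω : BondConfig (Site 3)) (u v : Site 3),
      (zdGraph 3).Adj u v →
      (∃ a ∈ A, ∃ b ∈ B, ω ∈ openConnIn S a u ∧ ω ∈ openConnIn S u b) →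
      (∃ a ∈ A, ∃ b ∈ B, ω ∈ openConnIn S a v ∧ ω ∈ openConnIn S v b) →
      ω ∉ openConnIn S u v →
      ((∃ x : Fin (k + 1) → Site 3, (∀ i, x i ∈ A ∧ ∃ b ∈ B, ω ∈ openConnIn S (x i) b) ∧
          ∀ i j, i ≠ j → ω ∉ openConnIn S (x i) (x j)) ∧
        ¬ ∃ x : Fin (k + 1 + 1) → Site 3, (∀ i, x i ∈ A ∧ ∃ b ∈ B, ω ∈ openConnIn S (x i) b) ∧
          ∀ i j, i ≠ j → ω ∉ openConnIn S (x i) (x j)) →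
      (∃ x : Fin k → Site 3, (∀ i, x i ∈ A ∧ ∃ b ∈ B, insert s(u, v) ω ∈ openConnIn S (x i) b) ∧
          ∀ i j, i ≠ j → insert s(u, v) ω ∉ openConnIn S (x i) (x j)) ∧
        ¬ ∃ x : Fin (k + 1) → Site 3, (∀ i, x i ∈ A ∧ ∃ b ∈ B, insert s(u, v) ω ∈ openConnIn S (x i) b) ∧
          ∀ i j, i ≠ j → insert s(u, v) ω ∉ openConnIn S (x i) (x j) := by
  sorry

/-- **stub_doorTransfer** (size M–L, provable now; GENERIC single-edge flux inequality for bond percolation on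
`ℤ³` at any density `p`).  Data: a finite pair set `E`, levels `L j` determined by `E`, a door selection
`D ω ⊆ E` of CLOSED lattice edges, congruent under agreement on `E`, with the merge property
`ω ∈ L k, e ∈ D ω ⇒ insert e ω ∈ L (k-1)`.  Conclusion: `p · P_p(L k ∩ {D ≠ ∅}) ≤ ∫_{L (k-1)} F dP_p` for the
fibre weight `F(ω') = Σ_{b ∈ E} 1{b ∈ ω', ω' ∖ b ∈ L k, b ∈ D(ω' ∖ b)} / |D(ω' ∖ b)|`.  Why true: on
`L k ∩ {D ≠ ∅}`, `1 = Σ_{e ∈ D ω} 1/|D ω| = Σ_{e ∈ D ω} G_e(insert e ω)` with `G_e` the `e`-th summand of `F`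
(doors are closed, so `(insert e ω) ∖ e = ω`), `≤ Σ_{e ∈ E} G_e(insert e ω)`; insertion tolerance
`p ∫ G_e ∘ insert_e ≤ ∫ G_e` (tree `AKN.mul_real_preimage_insert_le` on the finitely many level sets of the
simple function `G_e`, all determined by `E`, `DeterminedBy.measurableSet_of_finset`); `Σ_e G_e = F` vanishes
off `L (k-1)` by the merge property (`insert b (ω ∖ b) = ω` for `b ∈ ω`); `integral_finset_sum`. -/
theorem stub_doorTransfer :
    ∀ (p : unitInterval) (E : Finset (Sym2 (Site 3))) (L : ℕ → Set (BondConfig (Site 3)))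
      (D : BondConfig (Site 3) → Finset (Sym2 (Site 3))) (k : ℕ),
      (∀ j, DeterminedBy (L j) (↑E : Set (Sym2 (Site 3)))) →
      (∀ ω ω' : BondConfig (Site 3), ω ∩ ↑E = ω' ∩ ↑E → D ω = D ω') →
      (∀ ω : BondConfig (Site 3), ∀ e ∈ D ω, e ∈ E ∧ e ∈ (zdGraph 3).edgeSet ∧ e ∉ ω) →
      (∀ ω : BondConfig (Site 3), ω ∈ L k → ∀ e ∈ D ω, insert e ω ∈ L (k - 1)) →
      (p : ℝ) * (bondPercolation (zdGraph 3) p).real (L k ∩ {ω | (D ω).Nonempty}) ≤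
        ∫ ω in L (k - 1),
          (∑ b ∈ E, Set.indicator {ω' : BondConfig (Site 3) | b ∈ ω' ∧ ω' \ {b} ∈ L k ∧ b ∈ D (ω' \ {b})}
            (fun ω' => (1 : ℝ) / ((D (ω' \ {b})).card : ℝ)) ω) ∂(bondPercolation (zdGraph 3) p) := by
  sorry

/-- **stub_doorCauchySchwarz** (size M, provable now; GENERIC).  For an event `A` and a bounded non-negative
function `F`, both determined by a finite pair set `E` (hence measurable / integrable:
`DeterminedBy.measurableSet_of_finset`; `F` is a finite combination of indicators of the `E`-cylinders
`{ω | ω ∩ E = η}`), Cauchy–Schwarz on `F = F · 1{F ≠ 0}`: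
`(∫_A F)² ≤ P_p(A ∩ {F ≠ 0}) · ∫_A F²` (Mathlib `integral_mul_le_Lp_mul_Lq_of_nonneg` with `p = q = 2`, or
`inner_mul_le_norm_mul_norm` in `L²`). -/
theorem stub_doorCauchySchwarz :
    ∀ (p : unitInterval) (E : Finset (Sym2 (Site 3))) (A : Set (BondConfig (Site 3)))
      (F : BondConfig (Site 3) → ℝ) (B : ℝ),
      DeterminedBy A (↑E : Set (Sym2 (Site 3))) →
      (∀ ω ω' : BondConfig (Site 3), ω ∩ ↑E = ω' ∩ ↑E → F ω = F ω') →
      (∀ ω, 0 ≤ F ω) → (∀ ω, F ω ≤ B) →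
      (∫ ω in A, F ω ∂(bondPercolation (zdGraph 3) p)) ^ 2 ≤
        (bondPercolation (zdGraph 3) p).real (A ∩ {ω | F ω ≠ 0}) *
          ∫ ω in A, F ω ^ 2 ∂(bondPercolation (zdGraph 3) p) := by
  sorry

/-- **stub_boundedFibre** (OPEN, the shape input of the door engine; sources: card single-edge-doors-flux-balance
(`BoundedFibre`, numerics `Φ` = E[avgFibre | N = k, K ≥ 1] = E[F²; N=k-1]/E[F; N=k-1] by the flux identity
= 1.9 / 2.0 / 2.3 / 2.3 / 1.5 at `r` = 4, 6, 8, 12, 16, `M = 8`, kit j012975/j012976)).  **Bounded fibre in the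
tight regime**: if `TightAt(M, k₀)`, then for every level `2 ≤ k ≤ k₀` there is `C > 0` with
`E[F_k² ; N(r,Mr) = k-1] ≤ C · E[F_k ; N(r,Mr) = k-1]` for all large `r` — merging two kissing crossing clusters
through a uniformly chosen kiss edge creates, on average, `O(1)` fibre weight (no heavy tail of necklace-like
level-`(k-1)` clusters carrying many splitting bridges with few re-contacts).  Why it might fail: unique
crossing clusters of long shells carry `E[#bridges | N = 1] ∝ r^{1.12}` splitting bridges in swarms; the
weight `1/K(ω' ∖ b)` tames a bridge only when the two halves re-touch often; a `(log r)^s` growth with `s < 1`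
would still be admissible for the landed polylog-sparse chain but not for this constant form. -/
theorem stub_boundedFibre :
    ∀ (M k₀ k : ℕ), 2 ≤ M →
      (∃ c₀ : ℝ, 0 < c₀ ∧ ∃ r₀ : ℕ, ∀ r : ℕ, r₀ ≤ r → Pc.real (AtLeast r (M * r) (k₀ + 1)) ≤ 1 - c₀) →
      2 ≤ k → k ≤ k₀ →
        ∃ C : ℝ, 0 < C ∧ ∃ r₁ : ℕ, ∀ r : ℕ, r₁ ≤ r →
          ∫ ω in Level r (M * r) (k - 1), fibre r (M * r) k ω ^ 2 ∂Pc ≤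
            C * ∫ ω in Level r (M * r) (k - 1), fibre r (M * r) k ω ∂Pc := by
  sorry

/-! ### Proved: instantiation glue for the door engine -/

/-- The closed shell as a set is the coercion of the closed shell as a `Finset`. -/
theorem coe_shellF (r R : ℕ) : (↑(shellF r R) : Set (Site 3)) = shell r R := by
  simp only [shellF, shell, Finset.coe_sdiff]

/-- The pairs of the shell contain `(shell r R).sym2`. -/
theorem shell_sym2_subset (r R : ℕ) : (shell r R).sym2 ⊆ (↑(shellPairs r R) : Set (Sym2 (Site 3))) := by
  rw [shellPairs, Finset.coe_sym2, coe_shellF]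

/-- Configurations agreeing on the shell pairs lie in the same shell connection events. -/
theorem openConnIn_congr {r R : ℕ} {ω ω' : BondConfig (Site 3)}
    (h : ω ∩ ↑(shellPairs r R) = ω' ∩ ↑(shellPairs r R)) (x y : Site 3) :
    ω ∈ openConnIn (shell r R) x y ↔ ω' ∈ openConnIn (shell r R) x y :=
  Theorems.NearLinearTwoClusterDecayShellIndep.mem_openConnIn_congr (shell_sym2_subset r R) h x y

/-- `{N ≥ k}` is determined by the shell pairs. -/
theorem determinedBy_atLeast (r R k : ℕ) :
    DeterminedBy (AtLeast r R k) (↑(shellPairs r R) : Set (Sym2 (Site 3))) := by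
  rw [determinedBy_iff]
  intro ω ω' h
  simp only [AtLeast, crossPts, Set.mem_setOf_eq, openConnIn_congr h]

/-- `{N = k}` is determined by the shell pairs. -/
theorem determinedBy_level (r R k : ℕ) :
    DeterminedBy (Level r R k) (↑(shellPairs r R) : Set (Sym2 (Site 3))) := by
  rw [determinedBy_iff]
  intro ω ω' h
  simp only [Level, Set.mem_sdiff, (determinedBy_iff _ _).1 (determinedBy_atLeast r R k) ω ω' h,
    (determinedBy_iff _ _).1 (determinedBy_atLeast r R (k + 1)) ω ω' h]

/-- `{N ≥ k}` is measurable. -/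
theorem measurableSet_atLeast (r R k : ℕ) : MeasurableSet (AtLeast r R k) :=
  (determinedBy_atLeast r R k).measurableSet_of_finset

/-- The kiss edges are congruent under agreement on the shell pairs. -/
theorem kissEdges_congr {r R : ℕ} {ω ω' : BondConfig (Site 3)}
    (h : ω ∩ ↑(shellPairs r R) = ω' ∩ ↑(shellPairs r R)) : kissEdges r R ω = kissEdges r R ω' := by
  classical
  unfold kissEdges
  refine Finset.filter_congr fun e _ => ?_
  simp only [crossBody, Set.mem_setOf_eq, openConnIn_congr h]

/-- Endpoints of shell connection events lie in the shell. -/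
theorem mem_shell_of_openConnIn {r R : ℕ} {ω : BondConfig (Site 3)} {x y : Site 3}
    (h : ω ∈ openConnIn (shell r R) x y) : x ∈ shell r R ∧ y ∈ shell r R := by
  obtain ⟨hx, hy, -⟩ := h
  exact ⟨hx, hy⟩

/-- An open lattice edge of the shell joins its endpoints inside the shell. -/
theorem openConnIn_of_mem {r R : ℕ} {ω : BondConfig (Site 3)} {u v : Site 3} (huv : (zdGraph 3).Adj u v)
    (hu : u ∈ shell r R) (hv : v ∈ shell r R) (he : s(u, v) ∈ ω) : ω ∈ openConnIn (shell r R) u v :=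
  DCT16.mem_openConnIn_iff_pathIn.2 (PathIn.of_adj hu hv ((openGraph_adj ω u v).2 ⟨he, huv.ne⟩))

/-- Kiss edges are lattice edges among the shell pairs, and they are CLOSED. -/
theorem kissEdges_spec (r R : ℕ) (ω : BondConfig (Site 3)) :
    ∀ e ∈ kissEdges r R ω, e ∈ shellPairs r R ∧ e ∈ (zdGraph 3).edgeSet ∧ e ∉ ω := by
  classical
  intro e he
  unfold kissEdges at he
  rw [Finset.mem_filter] at he
  obtain ⟨heP, heE, u, v, rfl, hu, hv, huv⟩ := he
  refine ⟨heP, heE, fun heω => huv ?_⟩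
  obtain ⟨x, -, y, -, hxu, huy⟩ := hu
  obtain ⟨x', -, y', -, hxv, hvy⟩ := hv
  exact openConnIn_of_mem ((SimpleGraph.mem_edgeSet _).1 heE) (mem_shell_of_openConnIn hxu).2
    (mem_shell_of_openConnIn hxv).2 heω

/-- A kiss produces a kiss edge. -/
theorem kissEdges_nonempty_of_kiss {r R : ℕ} {ω : BondConfig (Site 3)} (h : ω ∈ Kiss r R) :
    (kissEdges r R ω).Nonempty := by
  classical
  obtain ⟨u, v, hadj, hu, hv, huv⟩ := h
  refine ⟨s(u, v), ?_⟩
  unfold kissEdges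
  rw [Finset.mem_filter]
  refine ⟨?_, (SimpleGraph.mem_edgeSet _).2 hadj, u, v, rfl, hu, hv, huv⟩
  obtain ⟨x, -, y, -, hxu, -⟩ := hu
  obtain ⟨x', -, y', -, hxv, -⟩ := hv
  have hu' : u ∈ shellF r R := by
    rw [← Finset.mem_coe, coe_shellF]; exact (mem_shell_of_openConnIn hxu).2
  have hv' : v ∈ shellF r R := by
    rw [← Finset.mem_coe, coe_shellF]; exact (mem_shell_of_openConnIn hxv).2
  exact Finset.mk_mem_sym2_iff.2 ⟨hu', hv'⟩

/-- The merge property of the kiss edges (instance of `stub_kissMerge` with `S = shell r R`, `A = sphere r`,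
`B = sphere R`): opening a kiss edge of a level-`(k+1)` configuration gives a level-`k` configuration. -/
theorem insert_mem_level {r R k : ℕ} {ω : BondConfig (Site 3)} (hω : ω ∈ Level r R (k + 1))
    {e : Sym2 (Site 3)} (he : e ∈ kissEdges r R ω) : insert e ω ∈ Level r R k := by
  classical
  unfold kissEdges at he
  rw [Finset.mem_filter] at he
  obtain ⟨-, heE, u, v, rfl, hu, hv, huv⟩ := he
  obtain ⟨x, hx, y, hy, hxu, huy⟩ := hu
  obtain ⟨x', hx', y', hy', hxv, hvy⟩ := hv
  have h := stub_kissMerge (shell r R) ↑(sphere r) ↑(sphere R) k ω u v ((SimpleGraph.mem_edgeSet _).1 heE)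
    ⟨x, hx, y, hy, hxu, huy⟩ ⟨x', hx', y', hy', hxv, hvy⟩ huv ⟨hω.1, hω.2⟩
  exact ⟨h.1, h.2⟩

/-- The merge property in the form consumed by the door transfer (`k ≥ 1`). -/
theorem insert_mem_level_pred {r R k : ℕ} (hk : 1 ≤ k) {ω : BondConfig (Site 3)} (hω : ω ∈ Level r R k)
    {e : Sym2 (Site 3)} (he : e ∈ kissEdges r R ω) : insert e ω ∈ Level r R (k - 1) := by
  obtain ⟨j, rfl⟩ : ∃ j, k = j + 1 := ⟨k - 1, by omega⟩
  rw [Nat.add_sub_cancel]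
  exact insert_mem_level hω he

/-- The fibre weight is congruent under agreement on the shell pairs. -/
theorem fibre_congr {r R k : ℕ} {ω ω' : BondConfig (Site 3)}
    (h : ω ∩ ↑(shellPairs r R) = ω' ∩ ↑(shellPairs r R)) : fibre r R k ω = fibre r R k ω' := by
  unfold fibre
  refine Finset.sum_congr rfl fun b hb => ?_
  have hbω : b ∈ ω ↔ b ∈ ω' := by
    have := congrArg (fun T : Set (Sym2 (Site 3)) => b ∈ T) h
    simpa [hb] using this
  have hagree : (ω \ {b}) ∩ ↑(shellPairs r R) = (ω' \ {b}) ∩ ↑(shellPairs r R) := by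
    rw [Set.sdiff_eq, Set.sdiff_eq, Set.inter_right_comm, h, Set.inter_right_comm]
  have hL : ω \ {b} ∈ Level r R k ↔ ω' \ {b} ∈ Level r R k :=
    (determinedBy_iff _ _).1 (determinedBy_level r R k) _ _ hagree
  have hK : kissEdges r R (ω \ {b}) = kissEdges r R (ω' \ {b}) := kissEdges_congr hagree
  by_cases hmem : ω ∈ {ω' : BondConfig (Site 3) | b ∈ ω' ∧ ω' \ {b} ∈ Level r R k ∧
      b ∈ kissEdges r R (ω' \ {b})}
  · have hmem' : ω' ∈ {ω' : BondConfig (Site 3) | b ∈ ω' ∧ ω' \ {b} ∈ Level r R k ∧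
        b ∈ kissEdges r R (ω' \ {b})} := by
      simp only [Set.mem_setOf_eq] at hmem ⊢
      exact ⟨hbω.1 hmem.1, hL.1 hmem.2.1, hK ▸ hmem.2.2⟩
    rw [Set.indicator_of_mem hmem, Set.indicator_of_mem hmem', hK]
  · have hmem' : ω' ∉ {ω' : BondConfig (Site 3) | b ∈ ω' ∧ ω' \ {b} ∈ Level r R k ∧
        b ∈ kissEdges r R (ω' \ {b})} := by
      simp only [Set.mem_setOf_eq] at hmem ⊢
      exact fun h' => hmem ⟨hbω.2 h'.1, hL.2 h'.2.1, hK.symm ▸ h'.2.2⟩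
    rw [Set.indicator_of_notMem hmem, Set.indicator_of_notMem hmem']

/-- The fibre weight is non-negative. -/
theorem fibre_nonneg (r R k : ℕ) (ω : BondConfig (Site 3)) : 0 ≤ fibre r R k ω := by
  unfold fibre
  refine Finset.sum_nonneg fun b _ => Set.indicator_nonneg (fun _ _ => ?_) _
  positivity

/-- The fibre weight is at most the number of shell pairs. -/
theorem fibre_le (r R k : ℕ) (ω : BondConfig (Site 3)) : fibre r R k ω ≤ (shellPairs r R).card := by
  unfold fibre
  have h : ∀ b ∈ shellPairs r R,
      Set.indicator {ω' : BondConfig (Site 3) | b ∈ ω' ∧ ω' \ {b} ∈ Level r R k ∧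
        b ∈ kissEdges r R (ω' \ {b})} (fun ω' => (1 : ℝ) / ((kissEdges r R (ω' \ {b})).card : ℝ)) ω ≤ 1 := by
    intro b _
    refine Set.indicator_apply_le' (fun _ => ?_) (fun _ => zero_le_one)
    by_cases h0 : (kissEdges r R (ω \ {b})).card = 0
    · rw [h0]; simp
    · have hpos : 0 < (kissEdges r R (ω \ {b})).card := Nat.pos_of_ne_zero h0
      rw [div_le_one (by exact_mod_cast hpos)]
      exact_mod_cast hpos
  calc _ ≤ ∑ b ∈ shellPairs r R, (1 : ℝ) := Finset.sum_le_sum h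
    _ = (shellPairs r R).card := by simp

/-! ### Proved: the kiss surgery from the door engine (stubs 4–7) -/

/-- `p_c(ℤ³) > 0` (bond), from the tree's proved Grimmett (1.10). -/
theorem pc_pos : 0 < ((criticalProbI 3 : unitInterval) : ℝ) := by
  rw [coe_criticalProbI]
  exact (Grimmett1999_criticalProb_pos_lt_one_holds 3 (by norm_num)).1

/-- **Kiss surgery in the tight regime** (the planner's `stub_kissSurgery`, now a theorem of stubs 4–7): for
`2 ≤ k ≤ k₀` there is `c > 0` with `c · P(N(r,Mr) = k, Kiss) ≤ 1 - P(N(r,Mr) ≥ k)` for all large `r`, with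
`c = p_c / C` (`C` from `stub_boundedFibre`).  Chain: `p_c P(N=k, Kiss) ≤ p_c P(L k ∩ {D ≠ ∅}) ≤ ∫_{N=k-1} F`
(door transfer) `≤ C · P(N = k-1, F ≠ 0)` (Cauchy–Schwarz + bounded fibre) `≤ C (1 - P(N ≥ k))`. -/
theorem kissSurgery (M k₀ k : ℕ) (hM : 2 ≤ M)
    (hT : ∃ c₀ : ℝ, 0 < c₀ ∧ ∃ r₀ : ℕ, ∀ r : ℕ, r₀ ≤ r → Pc.real (AtLeast r (M * r) (k₀ + 1)) ≤ 1 - c₀)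
    (hk : 2 ≤ k) (hkk₀ : k ≤ k₀) :
    ∃ c : ℝ, 0 < c ∧ ∃ r₁ : ℕ, ∀ r : ℕ, r₁ ≤ r →
      c * Pc.real (Level r (M * r) k ∩ Kiss r (M * r)) ≤ 1 - Pc.real (AtLeast r (M * r) k) := by
  obtain ⟨C, hC, r₁, hBF⟩ := stub_boundedFibre M k₀ k hM hT hk hkk₀
  refine ⟨(criticalProbI 3 : ℝ) / C, div_pos pc_pos hC, r₁, fun r hr => ?_⟩
  set R := M * r with hR
  -- the door transfer, instantiated
  have hDT := stub_doorTransfer (criticalProbI 3) (shellPairs r R) (Level r R) (kissEdges r R) k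
    (determinedBy_level r R) (fun ω ω' h => kissEdges_congr h) (kissEdges_spec r R)
    (fun ω hω e he => insert_mem_level_pred (by omega) hω he)
  change (criticalProbI 3 : ℝ) * Pc.real (Level r R k ∩ {ω | (kissEdges r R ω).Nonempty}) ≤
    ∫ ω in Level r R (k - 1), fibre r R k ω ∂Pc at hDT
  -- Cauchy–Schwarz, instantiated
  have hCS := stub_doorCauchySchwarz (criticalProbI 3) (shellPairs r R) (Level r R (k - 1)) (fibre r R k)
    ((shellPairs r R).card) (determinedBy_level r R (k - 1)) (fun ω ω' h => fibre_congr h)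
    (fibre_nonneg r R k) (fibre_le r R k)
  change (∫ ω in Level r R (k - 1), fibre r R k ω ∂Pc) ^ 2 ≤
    Pc.real (Level r R (k - 1) ∩ {ω | fibre r R k ω ≠ 0}) * ∫ ω in Level r R (k - 1), fibre r R k ω ^ 2 ∂Pc
    at hCS
  have hBF' := hBF r hr
  set I := ∫ ω in Level r R (k - 1), fibre r R k ω ∂Pc with hI
  set J := ∫ ω in Level r R (k - 1), fibre r R k ω ^ 2 ∂Pc with hJ
  set q := Pc.real (Level r R (k - 1) ∩ {ω | fibre r R k ω ≠ 0}) with hq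
  set P := Pc.real (AtLeast r R k) with hP
  have hI0 : 0 ≤ I :=
    setIntegral_nonneg (determinedBy_level r R (k - 1)).measurableSet_of_finset fun ω _ => fibre_nonneg r R k ω
  have hq0 : 0 ≤ q := measureReal_nonneg
  have hP1 : P ≤ 1 := measureReal_le_one
  -- `P(N = k-1, F ≠ 0) ≤ P(N = k-1) ≤ 1 - P(N ≥ k)` (disjointness + measurability of `{N ≥ k}`)
  have hq1 : q ≤ 1 - P := by
    have h1 : q ≤ Pc.real (Level r R (k - 1)) := measureReal_mono Set.inter_subset_left
    have hk1 : k - 1 + 1 = k := by omega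
    have hdisj : Disjoint (Level r R (k - 1)) (AtLeast r R k) := by
      rw [Set.disjoint_left]
      rintro ω ⟨-, hω⟩ hω'
      rw [hk1] at hω
      exact hω hω'
    have h2 : Pc.real (Level r R (k - 1)) + P ≤ 1 := by
      rw [hP, ← measureReal_union hdisj (measurableSet_atLeast r R k)]
      exact measureReal_le_one
    linarith
  -- `∫ F ≤ C (1 - P(N ≥ k))`
  have hIle : I ≤ C * (1 - P) := by
    by_cases hIpos : 0 < I
    · have h1 : I * I ≤ (q * C) * I := by
        have : q * J ≤ q * (C * I) := mul_le_mul_of_nonneg_left hBF' hq0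
        nlinarith [hCS, this]
      have h2 : I ≤ q * C := le_of_mul_le_mul_right h1 hIpos
      calc I ≤ q * C := h2
        _ ≤ (1 - P) * C := by gcongr
        _ = C * (1 - P) := by ring
    · have hI0' : I = 0 := le_antisymm (not_lt.1 hIpos) hI0
      rw [hI0']
      exact mul_nonneg hC.le (by linarith)
  -- `P(N = k, Kiss) ≤ P(L k ∩ {D ≠ ∅})`
  have hmono : Pc.real (Level r R k ∩ Kiss r R) ≤ Pc.real (Level r R k ∩ {ω | (kissEdges r R ω).Nonempty}) :=
    measureReal_mono (Set.inter_subset_inter_right _ fun ω hω => kissEdges_nonempty_of_kiss hω)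
  have hC1 : 0 ≤ 1 / C := by positivity
  calc (criticalProbI 3 : ℝ) / C * Pc.real (Level r R k ∩ Kiss r R)
      = (1 / C) * ((criticalProbI 3 : ℝ) * Pc.real (Level r R k ∩ Kiss r R)) := by ring
    _ ≤ (1 / C) * ((criticalProbI 3 : ℝ) * Pc.real (Level r R k ∩ {ω | (kissEdges r R ω).Nonempty})) :=
        mul_le_mul_of_nonneg_left (mul_le_mul_of_nonneg_left hmono pc_pos.le) hC1
    _ ≤ (1 / C) * I := mul_le_mul_of_nonneg_left hDT hC1
    _ ≤ (1 / C) * (C * (1 - P)) := mul_le_mul_of_nonneg_left hIle hC1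
    _ = 1 - P := by field_simp

/-! ### Proved: the descent (engine ⇒ `NP_M`; planner's arithmetic verbatim) -/

/-- `{N ≥ k + 1} ⊆ {N ≥ k}` (drop the last crossing point). -/
theorem atLeast_succ_subset (r R k : ℕ) : AtLeast r R (k + 1) ⊆ AtLeast r R k := by
  rintro ω ⟨x, hx, hdis⟩
  refine ⟨fun i => x (Fin.castSucc i), fun i => hx _, fun i j hij => hdis _ _ ?_⟩
  exact fun h => hij (Fin.castSucc_injective _ h)

/-- `{N ≥ k} ⊆ {N = k} ∪ {N ≥ k + 1}` (so `P(N ≥ k) ≤ P(N = k) + P(N ≥ k+1)` by subadditivity alone). -/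
theorem atLeast_subset_level_union (r R k : ℕ) :
    AtLeast r R k ⊆ Level r R k ∪ AtLeast r R (k + 1) := by
  intro ω hω
  by_cases h : ω ∈ AtLeast r R (k + 1)
  · exact Or.inr h
  · exact Or.inl ⟨hω, h⟩

/-- **One step of the kiss descent**: in the tight regime `TightAt(M, k₀)`, for `2 ≤ k ≤ k₀`,
`Good(M, k + 1) → Good(M, k)`, with `c_k = c_s c_t c_{k+1} / (1 + c_s c_t)` (kiss positivity `c_t`,
kiss surgery `c_s`). Only monotonicity and subadditivity of `Pc.real` are used. -/
theorem descent_step {M k₀ k : ℕ} (hM : 2 ≤ M)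
    (hT : ∃ c₀ : ℝ, 0 < c₀ ∧ ∃ r₀ : ℕ, ∀ r : ℕ, r₀ ≤ r → Pc.real (AtLeast r (M * r) (k₀ + 1)) ≤ 1 - c₀)
    (hk : 2 ≤ k) (hkk₀ : k ≤ k₀)
    (h : ∃ c : ℝ, 0 < c ∧ ∃ r₀ : ℕ, ∀ r : ℕ, r₀ ≤ r → Pc.real (AtLeast r (M * r) (k + 1)) ≤ 1 - c) :
    ∃ c : ℝ, 0 < c ∧ ∃ r₀ : ℕ, ∀ r : ℕ, r₀ ≤ r → Pc.real (AtLeast r (M * r) k) ≤ 1 - c := by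
  obtain ⟨c₁, hc₁, r₁, h₁⟩ := h
  obtain ⟨c₂, hc₂, r₂, h₂⟩ := stub_kissPositivity M k₀ k hM hT hk hkk₀
  obtain ⟨c₃, hc₃, r₃, h₃⟩ := kissSurgery M k₀ k hM hT hk hkk₀
  have hpos : 0 < 1 + c₃ * c₂ := by positivity
  refine ⟨c₃ * c₂ * c₁ / (1 + c₃ * c₂), by positivity, max r₁ (max r₂ r₃), fun r hr => ?_⟩
  have hr₁ : r₁ ≤ r := le_trans (le_max_left _ _) hr
  have hr₂ : r₂ ≤ r := le_trans ((le_max_left _ _).trans (le_max_right _ _)) hr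
  have hr₃ : r₃ ≤ r := le_trans ((le_max_right _ _).trans (le_max_right _ _)) hr
  have hu : Pc.real (AtLeast r (M * r) k) ≤
      Pc.real (Level r (M * r) k) + Pc.real (AtLeast r (M * r) (k + 1)) :=
    (measureReal_mono (atLeast_subset_level_union r (M * r) k)).trans (measureReal_union_le _ _)
  have e1 := h₁ r hr₁
  have e2 := h₂ r hr₂
  have e3 := h₃ r hr₃
  set u := Pc.real (AtLeast r (M * r) k) with hu_def
  set u' := Pc.real (AtLeast r (M * r) (k + 1)) with hu'_def
  set d := Pc.real (Level r (M * r) k) with hd_def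
  set t := Pc.real (Level r (M * r) k ∩ Kiss r (M * r)) with ht_def
  have hd : u - 1 + c₁ ≤ d := by linarith
  have h4 : c₃ * c₂ * (u - 1 + c₁) ≤ 1 - u :=
    calc c₃ * c₂ * (u - 1 + c₁) ≤ c₃ * c₂ * d := by
          apply mul_le_mul_of_nonneg_left hd; positivity
      _ = c₃ * (c₂ * d) := by ring
      _ ≤ c₃ * t := by apply mul_le_mul_of_nonneg_left e2 hc₃.le
      _ ≤ 1 - u := e3
  have key : c₃ * c₂ * c₁ / (1 + c₃ * c₂) ≤ 1 - u := by
    rw [div_le_iff₀ hpos]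
    nlinarith [h4]
  linarith

/-- **The engine gives non-proliferation**: `stub_tightAtSomeAspect` + `stub_kissPositivity` + `kissSurgery`
⟹ `NP_M = Good(M, 2)` at the tight aspect `M` (descend from level `k₀ + 1` to level `2`; for `k₀ ≤ 1` tightness
is already `NP_M` by monotonicity). -/
theorem good_two_of_tight :
    ∃ M : ℕ, 2 ≤ M ∧ ∃ c : ℝ, 0 < c ∧ ∃ r₀ : ℕ, ∀ r : ℕ, r₀ ≤ r → Pc.real (AtLeast r (M * r) 2) ≤ 1 - c := by
  obtain ⟨M, hM, k₀, hT⟩ := stub_tightAtSomeAspect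
  refine ⟨M, hM, ?_⟩
  rcases Nat.lt_or_ge k₀ 1 with hk | hk
  · have hk0 : k₀ = 0 := by omega
    subst hk0
    obtain ⟨c, hc, r₀, h₀⟩ := hT
    exact ⟨c, hc, r₀, fun r hr => (measureReal_mono (atLeast_succ_subset r (M * r) 1)).trans (h₀ r hr)⟩
  · have key : ∀ d k : ℕ, 2 ≤ k → k + d = k₀ + 1 →
        ∃ c : ℝ, 0 < c ∧ ∃ r₀ : ℕ, ∀ r : ℕ, r₀ ≤ r → Pc.real (AtLeast r (M * r) k) ≤ 1 - c := by
      intro d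
      induction d with
      | zero =>
        intro k _ hkd
        rw [Nat.add_zero] at hkd
        rw [hkd]
        exact hT
      | succ d ih =>
        intro k hk hkd
        exact descent_step hM hT hk (by omega) (ih (k + 1) (by omega) (by omega))
    exact key (k₀ - 1) 2 le_rfl (by omega)

/-! ### Proved: the transfer `NP_M ⇒ crux` through the LANDED open-shell chain -/

/-- The landed open-shell event `Sh(N, R)` is contained in `{N(N+1, R) ≥ 2}` (`stub_shellEncoding` read in this
file's vocabulary; definitional). -/
theorem sh_subset_atLeast_two (N R : ℕ) :
    {ω : BondConfig (Site 3) | ∃ u ∈ (↑(box 3 (N + 1)) : Set (Site 3)) \ ↑(box 3 N),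
        ∃ u' ∈ (↑(box 3 (N + 1)) : Set (Site 3)) \ ↑(box 3 N),
        ∃ v ∈ innerBoundary (zdGraph 3) (box 3 R), ∃ v' ∈ innerBoundary (zdGraph 3) (box 3 R),
          ω ∈ openConnIn ((↑(box 3 R) : Set (Site 3)) \ ↑(box 3 N)) u v ∧
          ω ∈ openConnIn ((↑(box 3 R) : Set (Site 3)) \ ↑(box 3 N)) u' v' ∧
          ω ∉ openConnIn ((↑(box 3 R) : Set (Site 3)) \ ↑(box 3 N)) u u'} ⊆ AtLeast (N + 1) R 2 :=
  fun ω h => stub_shellEncoding N R ω h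

/-- **Transfer to the clean open-shell `NP_{2M}`**: non-proliferation at one bounded CLOSED-shell aspect `M ≥ 2`
(`Good(M, 2) = NP_M`) gives the hypothesis of the landed chain at aspect `2M`: for `N ≥ max r₀ 1` the open
shell `Λ(2MN) ∖ Λ(N)` contains the closed shell `S(N+1, M(N+1))` (`M(N+1) ≤ 2MN`), so
`P(Sh(N, 2MN)) ≤ P(Sh(N, M(N+1))) ≤ P(N(N+1, M(N+1)) ≥ 2) ≤ 1 - c` (`Theorems.real_shellTwoCluster_antitone`,
`sh_subset_atLeast_two`). -/
theorem nonCertainty_of_goodTwo {M : ℕ} (hM : 2 ≤ M)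
    (hG : ∃ c : ℝ, 0 < c ∧ ∃ r₀ : ℕ, ∀ r : ℕ, r₀ ≤ r → Pc.real (AtLeast r (M * r) 2) ≤ 1 - c) :
    ∃ M' : ℕ, 2 ≤ M' ∧ ∃ ε : ℝ, 0 < ε ∧ ∀ᶠ N : ℕ in atTop,
      (bondPercolation (zdGraph 3) (criticalProbI 3)).real
          {ω | ∃ u ∈ (↑(box 3 (N + 1)) : Set (Site 3)) \ ↑(box 3 N),
            ∃ u' ∈ (↑(box 3 (N + 1)) : Set (Site 3)) \ ↑(box 3 N),
            ∃ v ∈ innerBoundary (zdGraph 3) (box 3 (M' * N)),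
            ∃ v' ∈ innerBoundary (zdGraph 3) (box 3 (M' * N)),
              ω ∈ openConnIn ((↑(box 3 (M' * N)) : Set (Site 3)) \ ↑(box 3 N)) u v ∧
              ω ∈ openConnIn ((↑(box 3 (M' * N)) : Set (Site 3)) \ ↑(box 3 N)) u' v' ∧
              ω ∉ openConnIn ((↑(box 3 (M' * N)) : Set (Site 3)) \ ↑(box 3 N)) u u'}
        ≤ 1 - ε := by
  obtain ⟨c, hc, r₀, h⟩ := hG
  refine ⟨2 * M, by omega, c, hc, ?_⟩
  filter_upwards [eventually_ge_atTop (max r₀ 1)] with N hN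
  have hN1 : 1 ≤ N := le_trans (le_max_right _ _) hN
  have hr : r₀ ≤ N + 1 := le_trans (le_max_left _ _) (hN.trans (Nat.le_succ N))
  have h1 : N < M * (N + 1) := by nlinarith
  have h2 : M * (N + 1) ≤ 2 * M * N := by nlinarith
  refine (Theorems.real_shellTwoCluster_antitone (criticalProbI 3) (le_refl N) h1 h2).trans ?_
  exact (measureReal_mono (sh_subset_atLeast_two N (M * (N + 1)))).trans (h (N + 1) hr)

/-! ### The composition -/

/-- **Composition `NearLinearTwoClusterDecay_of`.** The seven stubs imply the crux `NearLinearTwoClusterDecay`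
BY NAME: the engine (`stub_tightAtSomeAspect`, `stub_kissPositivity`, and `kissSurgery` from `stub_kissMerge`,
`stub_doorTransfer`, `stub_doorCauchySchwarz`, `stub_boundedFibre`) gives `NP_M` at the tight aspect
(`good_two_of_tight`), `stub_shellEncoding` re-encodes it as the clean open-shell `NP_{2M}`
(`nonCertainty_of_goodTwo`), and the LANDED `Theorems.nearLinearTwoClusterDecay_of_fixedAspectShellNonCertainty`
(orange-peeling chain) concludes. -/
theorem NearLinearTwoClusterDecay_of :
    Summit.CriticalPhenomena.PercolationContinuityZ3.Theses.PercShatteringRace.NearLinearTwoClusterDecay := by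
  obtain ⟨M, hM, hG⟩ := good_two_of_tight
  exact Theorems.nearLinearTwoClusterDecay_of_fixedAspectShellNonCertainty (nonCertainty_of_goodTwo hM hG)

/-- **Bonus edge**: the same seven stubs close `PercFiniteBoxLRO.CritBoxTwoArmsDecay` (stmt-0859, two-cluster
decay at EVERY aspect exponent `α > 1`) through the landed
`Theorems.critBoxTwoArmsDecay_of_fixedAspectShellNonCertainty`. -/
theorem CritBoxTwoArmsDecay_of :
    Summit.CriticalPhenomena.PercolationContinuityZ3.Theses.PercFiniteBoxLRO.CritBoxTwoArmsDecay := by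
  obtain ⟨M, hM, hG⟩ := good_two_of_tight
  exact Theorems.critBoxTwoArmsDecay_of_fixedAspectShellNonCertainty (nonCertainty_of_goodTwo hM hG)

end Summit.CriticalPhenomena.PercolationContinuityZ3.Cruxes.NearLinearTwoClusterDecay.ShellProductKissPositivity

end
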